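import Summits.QuantumAdvantage.AdviceFreeQNC0.ResidueAvoidanceLemmas
import Mathlib.Analysis.SpecificLimits.Normed
import HarnessLib

/-!
# Cell qa-qnc0 (odd primes, rung F-Q2): low-degree one-sided MOD₃-avoiders are sparse over ANY
# field of prime characteristic `p ≠ 3` (β-chain of RingFrame, re-run with scale `q = p^j`)

The β-side of route RingFrame (`LowDegreeResidueAvoidance.lean`, `EliminationHardness.lean`) was
written for characteristic `2` (scale `q = 2^j`).  Srinivasan's robust Hegedűs lemma (tree THEOREM
`Hegedus.nzFrac_lt_of_lowDeg`, Srinivasan 2023 Lemma 3.1) holds in every characteristic `p` with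
shifts `q = p^j`, and `3 ∤ p^j` for `p ≠ 3`, so the whole chain re-runs over `𝔽_p` (planner
qa-qnc0-p2 ROUND-12 §B.6(b) / ROUND-13 §6: the input `ElimHardF p` of the rungs R2–R4
`WalkHardFAnchored/Gap/Sparse p`; prover memo PROVER-MEMO-gen10 §4).  This file PROVES:

* `card_support_le_of_sparse_residue_classF p` — for every prime `p ≠ 3` and `γ > 0` there are
  `η, c₁ > 0`, `n₀` (depending on `p`, `γ`) such that for every field `F` of characteristic `p`,
  `n ≥ n₀`, residue `r`, degree `d ≤ c₁√n` and `g ∈ lowDeg F n d`: if `supp g` meets the class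
  `|u| ≡ r (mod 3)` in `≤ η·2ⁿ` points then `|supp g| ≤ γ·2ⁿ`.  Proof = the characteristic-2 proof
  VERBATIM with the scale `q = p^j ∈ (√(λn), p(√(λn)+1)]` (`exists_prime_pow_btwn`), window factor
  `q² ≤ 16·p²λ·n`, thresholds `εA = min(e^{−6400p²λ}, 1/1000)`, `ρ = e^{512p²λ}`, `n₀ ≥ 2²⁰p²λ`.
* `lowDegAvoidMod3SparseF p` — the `ZMod p` instance (shape of RingFrame's `LowDegAvoidMod3Sparse`).
The elimination corollaries (`elimLevelSqrtF`, `ElimHardF p` / `elimHardF`) are in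
`EliminationHardnessF.lean`.

WHAT THIS IS NOT: nothing on the u-walk game itself (`WalkHardF p` OPEN); no separation claim.

## References

* S. Srinivasan, *A robust version of Hegedűs's lemma, with applications*, TheoretiCS 2 (2023),
  Lemma 3.1 [Srinivasan2023].
-/

noncomputable section

namespace Summit.QuantumAdvantage.AdviceFreeQNC0

open Finset
open Literature.Computability.MetaComplexity Literature.Computability.MetaComplexity.Smolensky
open Literature.Computability.MetaComplexity.Hegedus

variable {n : ℕ}

/-! ### Powers of a prime as scales -/

/-- Between `m` and `p·m` there is a power of `p` (`m ≥ 1`, `p ≥ 2`). -/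
theorem exists_prime_pow_btwn {p : ℕ} (hp : 2 ≤ p) (m : ℕ) (hm : 0 < m) :
    ∃ j : ℕ, m < p ^ j ∧ p ^ j ≤ p * m := by
  refine ⟨Nat.log p m + 1, Nat.lt_pow_succ_log_self (by omega) m, ?_⟩
  rw [pow_succ, mul_comm]
  exact Nat.mul_le_mul_left _ (Nat.pow_log_le_self p (by omega))

/-- `p^j ≢ 0 (mod 3)` for a prime `p ≠ 3`. -/
theorem prime_pow_mod_three_ne_zero {p : ℕ} [Fact p.Prime] (hp3 : p ≠ 3) (j : ℕ) :
    p ^ j % 3 ≠ 0 := by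
  intro h
  have h3 : 3 ∣ p ^ j := Nat.dvd_of_mod_eq_zero h
  have h3p : 3 ∣ p := Nat.prime_three.dvd_of_dvd_pow h3
  exact hp3 ((Nat.prime_dvd_prime_iff_eq Nat.prime_three (Fact.out : p.Prime)).1 h3p).symm

/-! ### The theorem over `𝔽_p` -/

set_option maxHeartbeats 1600000 in
/-- **Low-degree one-sided MOD₃-avoiders are sparse, characteristic `p ≠ 3`** (any field `F` of
characteristic `p`): for every `γ > 0` there are `η, c₁ > 0` and `n₀` such that for `n ≥ n₀`, every
`r`, every `d ≤ c₁√n` and every `g ∈ lowDeg F n d`, if `#{u : g u ≠ 0, |u| ≡ r (mod 3)} ≤ η·2ⁿ`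
then `#{u : g u ≠ 0} ≤ γ·2ⁿ`.  Derived from Srinivasan's robust Hegedűs lemma [Srinivasan2023,
Lemma 3.1] (tree theorem `Hegedus.nzFrac_lt_of_lowDeg`, every characteristic) exactly as the
characteristic-`2` case `card_support_le_of_sparse_residue_class`, with scale `q = p^j`. -/
theorem card_support_le_of_sparse_residue_classF (p : ℕ) [Fact p.Prime] (hp3 : p ≠ 3)
    (γ : ℝ) (hγ : 0 < γ) :
    ∃ η : ℝ, 0 < η ∧ ∃ c₁ : ℝ, 0 < c₁ ∧ ∃ n₀ : ℕ,
      ∀ (F : Type) [Field F] [CharP F p] [DecidableEq F] (n : ℕ), n₀ ≤ n →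
        ∀ r d : ℕ, (d : ℝ) ≤ c₁ * Real.sqrt n →
        ∀ g : CubeFn F n, g ∈ lowDeg F n d →
          ((univ.filter fun u : Fin n → Bool => g u ≠ 0 ∧ wt u % 3 = r % 3).card : ℝ) ≤
              η * (2 : ℝ) ^ n →
          ((univ.filter fun u : Fin n → Bool => g u ≠ 0).card : ℝ) ≤ γ * (2 : ℝ) ^ n := by
  classical
  obtain ⟨cH, hcH, nH, hfact⟩ := nzFrac_lt_of_lowDeg
  /- constants (kept opaque: only the equations `hL`, `hεA`, … are used) -/
  obtain ⟨L, hL⟩ : ∃ L : ℕ, L = ⌈200 / γ⌉₊ + 200 := ⟨_, rfl⟩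
  have hL200 : (200 : ℝ) ≤ L := by
    have : (200 : ℕ) ≤ L := by omega
    exact_mod_cast this
  have hLγ : 200 / γ ≤ (L : ℝ) := by
    have h1 : 200 / γ ≤ (⌈200 / γ⌉₊ : ℝ) := Nat.le_ceil _
    have h2 : ((⌈200 / γ⌉₊ : ℕ) : ℝ) ≤ L := by
      rw [hL]; push_cast; linarith
    linarith
  have hLpos : (0 : ℝ) < L := by linarith
  have hL1 : 1 ≤ L := by omega
  obtain ⟨εB, hεB⟩ : ∃ εB : ℝ, εB = Real.exp (-((L : ℝ) / 50)) := ⟨_, rfl⟩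
  -- the prime enters only through the window factor `P = p²` (`q = p^j`, `λn < q² ≤ 4p²λn`)
  have hp2 : 2 ≤ p := (Fact.out : p.Prime).two_le
  obtain ⟨P, hP⟩ : ∃ P : ℝ, P = (p : ℝ) ^ 2 * L := ⟨_, rfl⟩
  have hP1 : (L : ℝ) ≤ P := by
    rw [hP]
    have : (4 : ℝ) ≤ (p : ℝ) ^ 2 := by
      have h : (2 : ℝ) ≤ p := by exact_mod_cast hp2
      nlinarith
    nlinarith
  obtain ⟨εA, hεA⟩ : ∃ εA : ℝ, εA = min (Real.exp (-(6400 * P))) (1 / 1000) := ⟨_, rfl⟩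
  obtain ⟨ρ, hρ⟩ : ∃ ρ : ℝ, ρ = Real.exp (512 * P) := ⟨_, rfl⟩
  have hεBpos : 0 < εB := by rw [hεB]; exact Real.exp_pos _
  have hεApos : 0 < εA := by rw [hεA]; exact lt_min (Real.exp_pos _) (by norm_num)
  have hεAle : εA ≤ 1 / 1000 := by rw [hεA]; exact min_le_right _ _
  have hεAexp : εA ≤ Real.exp (-(6400 * P)) := by rw [hεA]; exact min_le_left _ _
  have hPpos : 0 ≤ P := by rw [hP]; positivity
  have hρ1 : 1 ≤ ρ := by rw [hρ]; exact Real.one_le_exp (by positivity)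
  have hρpos : 0 < ρ := by rw [hρ]; exact Real.exp_pos _
  obtain ⟨η, hη⟩ : ∃ η : ℝ, η = γ * εA / (16 * ρ) := ⟨_, rfl⟩
  have hηpos : 0 < η := by rw [hη]; exact div_pos (mul_pos hγ hεApos) (by linarith)
  have hηle : η ≤ γ / 16 := by
    rw [hη, div_le_div_iff₀ (by linarith) (by norm_num)]
    have : εA ≤ ρ := by linarith
    nlinarith [mul_le_mul_of_nonneg_left this hγ.le]
  refine ⟨η, hηpos, cH, hcH, max nH (2 ^ 20 * p ^ 2 * L), ?_⟩
  intro F _ _ _ n hn r d hd g hg hSr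
  have hnH : nH ≤ n := le_trans (le_max_left _ _) hn
  have hnL : 2 ^ 20 * p ^ 2 * L ≤ n := le_trans (le_max_right _ _) hn
  have hbigpos : 0 < 2 ^ 20 * p ^ 2 * L :=
    Nat.mul_pos (Nat.mul_pos (by positivity) (pow_pos (Fact.out : p.Prime).pos 2)) (by omega)
  have hn0 : 0 < n := by omega
  have hnR : (0 : ℝ) < n := by exact_mod_cast hn0
  /- the scale `q`: a power of `p` with `L·n < q² ≤ 4p²·L·n ≤ 16·P·n` -/
  obtain ⟨j, hmq, hq2m⟩ := exists_prime_pow_btwn hp2 (Nat.sqrt (L * n) + 1) (Nat.succ_pos _)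
  obtain ⟨q, hq⟩ : ∃ q : ℕ, q = p ^ j := ⟨_, rfl⟩
  rw [← hq] at hmq hq2m
  have hsq1 : L * n < (Nat.sqrt (L * n) + 1) * (Nat.sqrt (L * n) + 1) := Nat.lt_succ_sqrt (L * n)
  have hsq2 : Nat.sqrt (L * n) * Nat.sqrt (L * n) ≤ L * n := Nat.sqrt_le (L * n)
  have hsq3 : 0 < Nat.sqrt (L * n) := Nat.sqrt_pos.2 (Nat.mul_pos (by omega) hn0)
  have hLn_lt : L * n < q * q := lt_of_lt_of_le hsq1 (Nat.mul_le_mul hmq.le hmq.le)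
  have hqq_le : q * q ≤ 16 * (p ^ 2 * L * n) := by
    have h3 : q ≤ 2 * p * Nat.sqrt (L * n) := by nlinarith
    calc q * q ≤ (2 * p * Nat.sqrt (L * n)) * (2 * p * Nat.sqrt (L * n)) := Nat.mul_le_mul h3 h3
      _ = 4 * p ^ 2 * (Nat.sqrt (L * n) * Nat.sqrt (L * n)) := by ring
      _ ≤ 4 * p ^ 2 * (L * n) := Nat.mul_le_mul_left _ hsq2
      _ ≤ 16 * (p ^ 2 * L * n) := by nlinarith
  have h256 : 256 * q ≤ n := by
    have h : (256 * q) * (256 * q) ≤ n * n := by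
      calc (256 * q) * (256 * q) = 65536 * (q * q) := by ring
        _ ≤ 65536 * (16 * (p ^ 2 * L * n)) := Nat.mul_le_mul_left _ hqq_le
        _ = (2 ^ 20 * p ^ 2 * L) * n := by ring
        _ ≤ n * n := Nat.mul_le_mul_right _ hnL
    exact Nat.mul_self_le_mul_self_iff.1 h
  have hq3 : q % 3 ≠ 0 := by rw [hq]; exact prime_pow_mod_three_ne_zero hp3 j
  have hqpos : 0 < q := by rw [hq]; positivity
  have hqR : (0 : ℝ) < q := by exact_mod_cast hqpos
  have hLn_ltR : (L : ℝ) * n < (q : ℝ) ^ 2 := by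
    rw [sq]; exact_mod_cast hLn_lt
  have hqq_leR : (q : ℝ) ^ 2 ≤ 16 * (P * n) := by
    rw [sq, hP]; exact_mod_cast hqq_le
  /- degree: `d < c_H · q` -/
  have hdq : (d : ℝ) < cH * q := by
    have hsqrt : Real.sqrt n < q := by
      rw [Real.sqrt_lt' hqR]
      nlinarith [mul_le_mul_of_nonneg_right (show (1 : ℝ) ≤ L by linarith) hnR.le]
    calc (d : ℝ) ≤ cH * Real.sqrt n := hd
      _ < cH * q := mul_lt_mul_of_pos_left hsqrt hcH
  /- layer sums: `N m = #{u ∈ layer m : g u ≠ 0}` -/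
  obtain ⟨N, hN⟩ : ∃ N : ℕ → ℕ, N = fun m => ((layer n m).filter fun u => g u ≠ 0).card :=
    ⟨_, rfl⟩
  have hNm : ∀ m, ((layer n m).filter fun u => g u ≠ 0).card = N m := fun m => by rw [hN]
  rw [card_filter_ne_zero_mod_eq_sum] at hSr
  rw [card_filter_ne_zero_eq_sum]
  simp only [hNm] at hSr ⊢
  push_cast at hSr ⊢
  have hN_le_C : ∀ m, (N m : ℝ) ≤ n.choose m := fun m => by
    rw [← hNm]; exact_mod_cast card_filter_layer_le_choose g m
  have hN_eq : ∀ {m}, m ≤ n → (N m : ℝ) = nzFrac g m * n.choose m := fun hm => by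
    rw [← hNm]; exact card_filter_layer_eq_nzFrac_mul g hm
  have hN_nonneg : ∀ m, (0 : ℝ) ≤ N m := fun m => Nat.cast_nonneg _
  have hsumC : ∑ m ∈ range (n + 1), (n.choose m : ℝ) = (2 : ℝ) ^ n := sum_range_choose_real n
  have h2n : (0 : ℝ) < (2 : ℝ) ^ n := by positivity
  /- (i) the tail: layers with `|2m - n| ≥ 2q` carry at most `n·2ⁿ/(4q²) ≤ (γ/800)·2ⁿ` points -/
  have htail : ∑ m ∈ (range (n + 1)).filter (fun m => ¬(n < 2 * m + 2 * q ∧ 2 * m < n + 2 * q)),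
      (N m : ℝ) ≤ γ / 800 * (2 : ℝ) ^ n := by
    have h4q : (0 : ℝ) < 4 * (q : ℝ) ^ 2 := mul_pos (by norm_num) (pow_pos hqR 2)
    calc ∑ m ∈ (range (n + 1)).filter (fun m => ¬(n < 2 * m + 2 * q ∧ 2 * m < n + 2 * q)),
          (N m : ℝ)
        ≤ ∑ m ∈ (range (n + 1)).filter (fun m => ¬(n < 2 * m + 2 * q ∧ 2 * m < n + 2 * q)),
          (n.choose m : ℝ) := sum_le_sum fun m _ => hN_le_C m
      _ ≤ n * (2 : ℝ) ^ n / (4 * (q : ℝ) ^ 2) := sum_choose_not_window_le n q hqpos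
      _ ≤ γ / 800 * (2 : ℝ) ^ n := by
          rw [div_le_iff₀ h4q]
          have h5 : (200 : ℝ) * n ≤ γ * (q : ℝ) ^ 2 := by
            have h1 : (200 / γ) * n ≤ (L : ℝ) * n := mul_le_mul_of_nonneg_right hLγ hnR.le
            have h2 : (200 : ℝ) * n = γ * ((200 / γ) * n) := by field_simp
            rw [h2]
            exact mul_le_mul_of_nonneg_left (by linarith) hγ.le
          nlinarith [mul_le_mul_of_nonneg_right h5 h2n.le]
  /- (ii) window layers of the class `r` itself: at most `η·2ⁿ` points by hypothesis -/
  have hWr : ∑ m ∈ ((range (n + 1)).filter (fun m => n < 2 * m + 2 * q ∧ 2 * m < n + 2 * q)).filter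
      (fun m => m % 3 = r % 3), (N m : ℝ) ≤ η * (2 : ℝ) ^ n := by
    refine le_trans (sum_le_sum_of_subset_of_nonneg ?_ fun m _ _ => hN_nonneg m) hSr
    intro m hm
    simp only [mem_filter] at hm ⊢
    exact ⟨hm.1.1, hm.2⟩
  /- the partner `k(m) ∈ {m - q, m + q}` with `k ≡ r (mod 3)` of a window layer `m ≢ r` -/
  obtain ⟨kf, hkf⟩ : ∃ kf : ℕ → ℕ, kf = fun m => if (m + q) % 3 = r % 3 then m + q else m - q :=
    ⟨_, rfl⟩
  have hk : ∀ m, m < n + 1 → (n < 2 * m + 2 * q ∧ 2 * m < n + 2 * q) → m % 3 ≠ r % 3 →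
      kf m % 3 = r % 3 ∧ 100 * q < kf m ∧ kf m + 100 * q < n ∧ n ≤ 4 * kf m ∧ 4 * kf m ≤ 3 * n ∧
      n / 2 ≤ kf m + 2 * q ∧ kf m ≤ n - n / 2 + 2 * q ∧ kf m ≤ n ∧
      ((kf m = m + q ∧ (m + q) % 3 = r % 3) ∨ (kf m = m - q ∧ q ≤ m ∧ (m + q) % 3 ≠ r % 3)) :=
    fun m hm hw hne => partner_facts h256 hq3 hm hw hne (congrFun hkf m)
  obtain ⟨A, hA⟩ : ∃ A : Finset ℕ, A = ((range (n + 1)).filter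
      (fun m => n < 2 * m + 2 * q ∧ 2 * m < n + 2 * q)).filter (fun m => ¬(m % 3 = r % 3)) :=
    ⟨_, rfl⟩
  have hAmem : ∀ m ∈ A, m < n + 1 ∧ (n < 2 * m + 2 * q ∧ 2 * m < n + 2 * q) ∧ m % 3 ≠ r % 3 := by
    intro m hm
    simp only [hA, mem_filter, mem_range] at hm
    exact ⟨hm.1.1, hm.1.2, hm.2⟩
  /- threshold comparisons for layers `k` in the middle half (`α(n,k) ∈ [1/4, 1/2]`) -/
  have hthrA : ∀ k, n ≤ 4 * k → 4 * k ≤ 3 * n →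
      εA ≤ min (Real.exp (-(100 * (q : ℝ) ^ 2 / (n * alphaOf n k)))) (1 / 1000) :=
    fun k h1 h2 => threshold_a hn0 h1 h2 hqq_leR hεAexp hεAle
  have hthrB : ∀ k, n ≤ 4 * k → 4 * k ≤ 3 * n →
      Real.exp (-((q : ℝ) ^ 2 / (100 * n * alphaOf n k))) ≤ εB :=
    fun k h1 h2 => hεB ▸ threshold_b hn0 h1 h2 hLn_ltR
  have hεBγ : εB ≤ γ / 4 := hεB ▸ exp_neg_le_quarter hγ hLγ
  /- (iii) good partners: layer `k(m)` is `εA`-sparse, so Lemma 3.1 makes layer `m` `εB`-sparse -/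
  have hgood : ∀ m ∈ A, nzFrac g (kf m) ≤ εA → (N m : ℝ) ≤ εB * n.choose m := by
    intro m hm hGd
    obtain ⟨hm1, hw, hne⟩ := hAmem m hm
    obtain ⟨hk3, hk100, hk100', hk4, hk4', hkw1, hkw2, hkn, hkm⟩ := hk m hm1 hw hne
    have hA' := le_trans hGd (hthrA (kf m) hk4 hk4')
    have hres := hfact p F n hnH (kf m) q d ⟨j, hq⟩ hk100 hk100' hdq g hg hA'
    have hB := hthrB (kf m) hk4 hk4'
    have hmle : m ≤ n := by omega
    rw [hN_eq hmle]
    refine mul_le_mul_of_nonneg_right ?_ (Nat.cast_nonneg _)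
    rcases hkm with ⟨hke, _⟩ | ⟨hke, hqm, _⟩
    · have e : m = kf m - q := by omega
      rw [e]
      exact (hres.2.trans_le hB).le
    · have e : m = kf m + q := by omega
      rw [e]
      exact (hres.1.trans_le hB).le
  /- (iv) bad partners: layer `k(m)` itself carries `> εA·C(n,k) ≥ (εA/ρ)·C(n,m)` points -/
  have hbad : ∀ m ∈ A, ¬(nzFrac g (kf m) ≤ εA) →
      (N m : ℝ) ≤ ρ / εA * N (kf m) := by
    intro m hm hGd
    rw [not_le] at hGd
    obtain ⟨hm1, hw, hne⟩ := hAmem m hm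
    obtain ⟨hk3, hk100, hk100', hk4, hk4', hkw1, hkw2, hkn, hkm⟩ := hk m hm1 hw hne
    have h16 : 8 * (2 * q) ≤ n := by omega
    have hC := choose_le_exp_mul_choose h16 (by omega : n / 2 ≤ kf m + 2 * q) (by omega) m
    have hexpρ : Real.exp (8 * ((2 * q : ℕ) : ℝ) ^ 2 / n) ≤ ρ := by
      rw [hρ]
      apply Real.exp_le_exp.2
      push_cast
      rw [div_le_iff₀ hnR]
      have e : (2 * (q : ℝ)) ^ 2 = 4 * (q : ℝ) ^ 2 := by ring
      rw [e]
      linarith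
    have hNk : εA * n.choose (kf m) < N (kf m) := by
      rw [hN_eq hkn]
      exact mul_lt_mul_of_pos_right hGd (by exact_mod_cast Nat.choose_pos hkn)
    have hCk : (0 : ℝ) ≤ n.choose (kf m) := Nat.cast_nonneg _
    calc (N m : ℝ) ≤ n.choose m := hN_le_C m
      _ ≤ Real.exp (8 * ((2 * q : ℕ) : ℝ) ^ 2 / n) * n.choose (kf m) := hC
      _ ≤ ρ * n.choose (kf m) := mul_le_mul_of_nonneg_right hexpρ hCk
      _ = ρ / εA * (εA * n.choose (kf m)) := by
          rw [← mul_assoc, div_mul_cancel₀ _ hεApos.ne']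
      _ ≤ ρ / εA * N (kf m) :=
          mul_le_mul_of_nonneg_left hNk.le (div_nonneg hρpos.le hεApos.le)
  /- the bad partners are `≡ r (mod 3)` and each is the partner of at most two layers -/
  have hsum_kf : ∑ m ∈ A.filter (fun m => ¬(nzFrac g (kf m) ≤ εA)), (N (kf m) : ℝ) ≤
      2 * (η * (2 : ℝ) ^ n) := by
    obtain ⟨B, hB⟩ : ∃ B : Finset ℕ, B = A.filter (fun m => ¬(nzFrac g (kf m) ≤ εA)) := ⟨_, rfl⟩
    rw [← hB]
    have hBA : B ⊆ A := by rw [hB]; exact filter_subset _ _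
    rw [← sum_filter_add_sum_filter_not B (fun m => (m + q) % 3 = r % 3)]
    have hplus : ∑ m ∈ B.filter (fun m => (m + q) % 3 = r % 3), (N (kf m) : ℝ) ≤
        η * (2 : ℝ) ^ n := by
      have e : ∀ m ∈ B.filter (fun m => (m + q) % 3 = r % 3), (N (kf m) : ℝ) =
          N (m + q) := by
        intro m hm
        rw [mem_filter] at hm
        simp only [hkf, if_pos hm.2]
      rw [sum_congr rfl e]
      have hinj : ∀ x ∈ B.filter (fun m => (m + q) % 3 = r % 3),
          ∀ y ∈ B.filter (fun m => (m + q) % 3 = r % 3), x + q = y + q → x = y := by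
        intro x _ y _ h; omega
      have himg : ∑ m ∈ B.filter (fun m => (m + q) % 3 = r % 3), (N (m + q) : ℝ) =
          ∑ k ∈ (B.filter (fun m => (m + q) % 3 = r % 3)).image (fun m => m + q),
            (N k : ℝ) :=
        (sum_image (f := fun k => (N k : ℝ)) (g := fun m => m + q) hinj).symm
      rw [himg]
      refine le_trans (sum_le_sum_of_subset_of_nonneg ?_ fun k _ _ => hN_nonneg k) hSr
      intro k hk'
      rw [mem_image] at hk'
      obtain ⟨m, hm, rfl⟩ := hk'
      rw [mem_filter] at hm
      obtain ⟨hm1, hw, hne⟩ := hAmem m (hBA hm.1)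
      rw [mem_filter, mem_range]
      exact ⟨by omega, hm.2⟩
    have hminus : ∑ m ∈ B.filter (fun m => ¬((m + q) % 3 = r % 3)), (N (kf m) : ℝ) ≤
        η * (2 : ℝ) ^ n := by
      have e : ∀ m ∈ B.filter (fun m => ¬((m + q) % 3 = r % 3)), (N (kf m) : ℝ) =
          N (m - q) := by
        intro m hm
        rw [mem_filter] at hm
        simp only [hkf, if_neg hm.2]
      rw [sum_congr rfl e]
      have hinj : ∀ x ∈ B.filter (fun m => ¬((m + q) % 3 = r % 3)),
          ∀ y ∈ B.filter (fun m => ¬((m + q) % 3 = r % 3)), x - q = y - q → x = y := by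
        intro x hx y hy h
        obtain ⟨hx1, hwx, _⟩ := hAmem x (hBA (mem_filter.1 hx).1)
        obtain ⟨hy1, hwy, _⟩ := hAmem y (hBA (mem_filter.1 hy).1)
        omega
      have himg : ∑ m ∈ B.filter (fun m => ¬((m + q) % 3 = r % 3)), (N (m - q) : ℝ) =
          ∑ k ∈ (B.filter (fun m => ¬((m + q) % 3 = r % 3))).image (fun m => m - q),
            (N k : ℝ) :=
        (sum_image (f := fun k => (N k : ℝ)) (g := fun m => m - q) hinj).symm
      rw [himg]
      refine le_trans (sum_le_sum_of_subset_of_nonneg ?_ fun k _ _ => hN_nonneg k) hSr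
      intro k hk'
      rw [mem_image] at hk'
      obtain ⟨m, hm, rfl⟩ := hk'
      have hm' := mem_filter.1 hm
      obtain ⟨hm1, hw, hne⟩ := hAmem m (hBA hm'.1)
      obtain ⟨hk3, -, -, -, -, -, -, hkn, hkm⟩ := hk m hm1 hw hne
      rw [mem_filter, mem_range]
      rcases hkm with ⟨_, hc⟩ | ⟨hke, hqm, _⟩
      · exact absurd hc hm'.2
      · rw [← hke]; exact ⟨by omega, hk3⟩
    linarith
  /- assembly -/
  have hsplit1 : ∑ m ∈ (range (n + 1)).filter (fun m => n < 2 * m + 2 * q ∧ 2 * m < n + 2 * q),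
        (N m : ℝ) +
      ∑ m ∈ (range (n + 1)).filter (fun m => ¬(n < 2 * m + 2 * q ∧ 2 * m < n + 2 * q)),
        (N m : ℝ) = ∑ m ∈ range (n + 1), (N m : ℝ) :=
    sum_filter_add_sum_filter_not _ _ _
  have hsplit2 : ∑ m ∈ ((range (n + 1)).filter
        (fun m => n < 2 * m + 2 * q ∧ 2 * m < n + 2 * q)).filter (fun m => m % 3 = r % 3),
        (N m : ℝ) +
      ∑ m ∈ ((range (n + 1)).filter
        (fun m => n < 2 * m + 2 * q ∧ 2 * m < n + 2 * q)).filter (fun m => ¬(m % 3 = r % 3)),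
        (N m : ℝ) =
      ∑ m ∈ (range (n + 1)).filter (fun m => n < 2 * m + 2 * q ∧ 2 * m < n + 2 * q),
        (N m : ℝ) :=
    sum_filter_add_sum_filter_not _ _ _
  have hsplit3 : ∑ m ∈ A.filter (fun m => nzFrac g (kf m) ≤ εA), (N m : ℝ) +
      ∑ m ∈ A.filter (fun m => ¬(nzFrac g (kf m) ≤ εA)), (N m : ℝ) =
      ∑ m ∈ A, (N m : ℝ) :=
    sum_filter_add_sum_filter_not _ _ _
  have hgood_sum : ∑ m ∈ A.filter (fun m => nzFrac g (kf m) ≤ εA), (N m : ℝ) ≤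
      γ / 4 * (2 : ℝ) ^ n := by
    calc ∑ m ∈ A.filter (fun m => nzFrac g (kf m) ≤ εA), (N m : ℝ)
        ≤ ∑ m ∈ A.filter (fun m => nzFrac g (kf m) ≤ εA), εB * (n.choose m : ℝ) :=
          sum_le_sum fun m hm => hgood m (mem_filter.1 hm).1 (mem_filter.1 hm).2
      _ ≤ ∑ m ∈ range (n + 1), εB * (n.choose m : ℝ) := by
          apply sum_le_sum_of_subset_of_nonneg
          · intro m hm
            exact mem_range.2 (hAmem m (mem_filter.1 hm).1).1
          · intro m _ _
            exact mul_nonneg hεBpos.le (Nat.cast_nonneg _)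
      _ = εB * (2 : ℝ) ^ n := by rw [← mul_sum, hsumC]
      _ ≤ γ / 4 * (2 : ℝ) ^ n := mul_le_mul_of_nonneg_right hεBγ h2n.le
  have hbad_sum : ∑ m ∈ A.filter (fun m => ¬(nzFrac g (kf m) ≤ εA)), (N m : ℝ) ≤
      γ / 8 * (2 : ℝ) ^ n := by
    calc ∑ m ∈ A.filter (fun m => ¬(nzFrac g (kf m) ≤ εA)), (N m : ℝ)
        ≤ ∑ m ∈ A.filter (fun m => ¬(nzFrac g (kf m) ≤ εA)), ρ / εA * (N (kf m) : ℝ) :=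
          sum_le_sum fun m hm => hbad m (mem_filter.1 hm).1 (mem_filter.1 hm).2
      _ = ρ / εA * ∑ m ∈ A.filter (fun m => ¬(nzFrac g (kf m) ≤ εA)),
            (N (kf m) : ℝ) := by rw [mul_sum]
      _ ≤ ρ / εA * (2 * (η * (2 : ℝ) ^ n)) :=
          mul_le_mul_of_nonneg_left hsum_kf (div_nonneg hρpos.le hεApos.le)
      _ = γ / 8 * (2 : ℝ) ^ n := by
          rw [hη]
          field_simp
          ring
  have hA_sum : ∑ m ∈ A, (N m : ℝ) ≤ (γ / 4 + γ / 8) * (2 : ℝ) ^ n := by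
    rw [← hsplit3]; linarith
  have hA_eq : ∑ m ∈ ((range (n + 1)).filter
      (fun m => n < 2 * m + 2 * q ∧ 2 * m < n + 2 * q)).filter (fun m => ¬(m % 3 = r % 3)),
      (N m : ℝ) = ∑ m ∈ A, (N m : ℝ) := by rw [hA]
  rw [← hsplit1, ← hsplit2, hA_eq]
  have hη2 : η * (2 : ℝ) ^ n ≤ γ / 16 * (2 : ℝ) ^ n := mul_le_mul_of_nonneg_right hηle h2n.le
  have hγ2 : 0 < γ * (2 : ℝ) ^ n := mul_pos hγ h2n
  linarith [htail, hWr, hA_sum, hη2, hγ2]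


/-- The `ZMod p` instance. -/
theorem lowDegAvoidMod3SparseF (p : ℕ) [Fact p.Prime] (hp3 : p ≠ 3) :
    ∀ γ : ℝ, 0 < γ → ∃ η : ℝ, 0 < η ∧ ∃ c₁ : ℝ, 0 < c₁ ∧ ∃ n₀ : ℕ, ∀ n ≥ n₀, ∀ r d : ℕ,
      (d : ℝ) ≤ c₁ * Real.sqrt n → ∀ g : Smolensky.CubeFn (ZMod p) n,
        g ∈ Smolensky.lowDeg (ZMod p) n d →
          ((Finset.univ.filter fun u : Fin n → Bool => g u ≠ 0 ∧ Hegedus.wt u % 3 = r % 3).card : ℝ)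
              ≤ η * (2 : ℝ) ^ n →
          ((Finset.univ.filter fun u : Fin n → Bool => g u ≠ 0).card : ℝ) ≤ γ * (2 : ℝ) ^ n := by
  intro γ hγ
  obtain ⟨η, hη, c₁, hc₁, n₀, h⟩ := card_support_le_of_sparse_residue_classF p hp3 γ hγ
  exact ⟨η, hη, c₁, hc₁, n₀, fun n hn r d hd g hg hS => h (ZMod p) n hn r d hd g hg hS⟩

end Summit.QuantumAdvantage.AdviceFreeQNC0
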